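import Summits.FinalStateConjecture.FinalStateConjecture.Theses.StarvedNecks
import Literature.Geometry.Lorentzian.KerrData
import Summits.FinalStateConjecture.FinalStateConjecture.Theorems.StarvedNecksHonestFixedRadiusSettlingStubFarExitAssembly
import Summits.FinalStateConjecture.FinalStateConjecture.Theorems.StarvedNecksHonestFixedRadiusSettlingStubFarExitZone
import Summits.FinalStateConjecture.FinalStateConjecture.Theorems.StarvedNecksHonestFixedRadiusSettlingStubFarExitChart
import Summits.FinalStateConjecture.FinalStateConjecture.Theorems.StarvedNecksHonestFixedRadiusSettlingStubFarExitTransport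
import Literature.Geometry.Lorentzian.FutureNullCompleteness

/-!
# Crux `HonestFixedRadiusSettling` (stmt-FinalStateConjecture-13550) · line
# `sojourn-needs-only-one-over-delta` · stub `stub_farExit` — FAR EXIT (exact Kerr transport)

The registered stub `stub_farExit` of the line skeleton, verbatim: under the seventeen clauses of
the one-atlas-at-infinity predicate, every normalised future null ray of the development starting
far out on the data hypersurface is future complete, or exits the exact flat zone
`Z = {−1 < y⁰, R♯(y⁰) < ‖y⃗‖}` through its inner boundary at a flat-charted late point with null
velocity `Φ_* w`, `0 < w⁰ ≤ L` (`L = 10`).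

Proof (layers H1–H3 of the helper files `…StubFarExitEnd/Energy/Zone/Escape/Kinematics/Chart/
Transport/Assembly`). Fix `τ`; take `B₁ = (φ {ρ₁ < ‖x‖})ᶜ`, `ρ₁ = R♯(0) + 4(|τ| + |τ₀| + 1)`.
A ray from `p = φ x`, `‖x‖ > ρ₁`, starts at `ι p = Φ(0, x)` (ATTACHED) inside `Z` (ZONE), where the
chart components `G♭ = Φ^* g` ARE the exact stationary Kerr components `gBL` (EXACT), nondegenerate
far out; so `dΦ` is invertible at `(0, x)`, `γ' 0 = dΦ w₀`, the unit normal is `dΦ n` with `n`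
the `gBL`-normal of the slice (`exists_normal_preimage`), the Killing energy
`E = −gBL(w₀, e₀)` is positive (ORIENTED, `energy_pos_of_isFutureDirected`) and `≤ 5`
(`zone_energy_pinning`). TRANSPORT (`transport`): `γ = Φ ∘ z` on a sub-interval `dom'` of its
domain, `z` the maximal `Φ^* g`-geodesic in the nondegeneracy locus `W ⊇ Z`, with the chart ODE,
momentum equations and the escape alternative. While `z ∈ Z` the energy is conserved
(`momentum_const`, `∂₀ gBL = 0`) so `0 < ż⁰ ≤ 10`, `‖ż⃗‖ ≤ (6/5) ż⁰`, `‖ż‖ ≤ 22` (`rate_bounds`).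
FIRST EXIT: if `z` leaves `Z` at a parameter `T ∈ dom'`, the point `z T` is on the inner boundary
(`exists_firstExit`, `spatialNorm_eq_of_frontier`), late by the displacement bound
(`displacement_le`, `late_of_boundary`: `z⁰(T) ≥ (5/16)(‖x‖ − R♯ 0) > max(τ, τ₀, 0)`), and
`(T, z T, ż T)` is the exit event (null by conservation of `G♭(ż, ż)`). NO EXIT: if `dom'` were
bounded above, `z` would converge (`exists_tendsto_of_norm_deriv_le`) to a far point `y*` of the
closure of `Z`, in the flat domain (ZONE, or SEPARATED at a late boundary point,
`mem_flatDomain_of_boundary`) and in `W` (`chartComponents_eq_of_mem_closure`), so the tangent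
lifts of `z` would stay in a compact set of `TW` — impossible for a maximal geodesic (escape lemma).
Hence `dom ⊇ dom'` is unbounded above.

References: B. O'Neill, *Semi-Riemannian geometry* (1983), Ch. 3, Ch. 5 (Lemma 8), Ch. 9
(Prop. 25); J. M. Lee, *Introduction to Riemannian Manifolds* (2018), Lemma 6.19; D. Christodoulou,
CQG 16 (1999) A23; M. Dafermos, I. Rodnianski, arXiv:0811.0354, §2.6.2 and §5.1.
-/

set_option linter.dupNamespace false

noncomputable section

open Literature.Geometry.Lorentzian
open scoped Manifold ContDiff ENNReal Topology
open Filter Set MeasureTheory Topology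

namespace Summit.FinalStateConjecture.FinalStateConjecture.Theorems.StarvedNecks.OneOverDelta

open Summit.FinalStateConjecture.FinalStateConjecture.Theorems.KerrShieldedDataExist.Negative
open Summit.FinalStateConjecture.FinalStateConjecture.Theorems.StarvedNecks.OneOverDelta.FarEnd
open Summit.FinalStateConjecture.FinalStateConjecture.Theorems.StarvedNecks.OneOverDelta.Kinematics
open Summit.FinalStateConjecture.FinalStateConjecture.Theorems.StarvedNecks.OneOverDelta.Transport
open Summit.FinalStateConjecture.FinalStateConjecture.Theorems.StarvedNecks.OneOverDelta.Assembly

/-- **Rates on the far zone.** A `G y`-null vector `u` at a far point with Killing energy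
`E = −G y (u, e₀) ∈ (0, 5]` has `0 < u⁰ ≤ 10`, `‖u⃗‖ ≤ (6/5) u⁰` and `‖u‖ ≤ 22` (`zone_null_energy`,
`norm_le_of_rate`). [cite: arXiv07060622, (32)–(35)] -/
theorem rate_bounds {M a : ℝ} {S : E4 → E4} {G : E4 → E4 →L[ℝ] E4 →L[ℝ] ℝ}
    (hS : ∀ y, S y = y + bentHeightFun M a (E4.spatial y) • E4.basisVector 0)
    (hG : ∀ y, G y = (Kerr.bilin M a (S y)).bilinearComp (fderiv ℝ S y) (fderiv ℝ S y))
    (hM : 0 ≤ M) (ha : |a| ≤ M) {y : E4} (hy : 16 * M + |a| + 1 ≤ E4.spatialNorm y)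
    {u : E4} {E : ℝ} (hnull : G y u u = 0) (hE : -(G y u (E4.basisVector 0)) = E) (hE0 : 0 < E)
    (hE5 : E ≤ 5) : 0 < u 0 ∧ u 0 ≤ 10 ∧ E4.spatialNorm u ≤ 6 / 5 * u 0 ∧ ‖u‖ ≤ 22 := by
  obtain ⟨h0, h2E, hsp⟩ := zone_null_energy hS hG hM ha hy hnull (by rw [hE]; exact hE0)
  rw [hE] at h2E
  have h10 : u 0 ≤ 10 := by linarith
  exact ⟨h0, h10, hsp, norm_le_of_rate h0 h10 hsp⟩

/-- Transport of future-directedness across an equality of base points (a cross-fibre statement: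
both tangent spaces are the model space `E4`). [folklore] -/
theorem isFutureDirected_of_eq_point {𝓢 : Spacetime 4} {x₁ x₂ : 𝓢.carrier} (h : x₁ = x₂) {v : E4}
    (hv : 𝓢.timeOrientation.IsFutureDirected (show TangentSpace (𝓡 4) x₁ from v)) :
    𝓢.timeOrientation.IsFutureDirected (show TangentSpace (𝓡 4) x₂ from v) := by
  subst h; exact hv

/-- The metric pairing across an equality of base points (cross-fibre). [folklore] -/
theorem metric_val_of_eq_point {𝓢 : Spacetime 4} {x₁ x₂ : 𝓢.carrier} (h : x₁ = x₂) (v w : E4) :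
    𝓢.metric.val x₁ (show TangentSpace (𝓡 4) x₁ from v) (show TangentSpace (𝓡 4) x₁ from w) =
      𝓢.metric.val x₂ (show TangentSpace (𝓡 4) x₂ from v) (show TangentSpace (𝓡 4) x₂ from w) := by
  subst h; rfl

/-- **FAR EXIT** — the registered stub `stub_farExit` of the line `sojourn-needs-only-one-over-delta`
(module docstring). [cite: ONeill1983, Ch. 5, Lemma 8] -/
theorem stub_farExit :
    let blH : ℝ → ℝ → ℝ → ℝ := fun M a r ↦
      Real.smoothTransition (r / (4 * M) - 1) *
        ((M / Real.sqrt (M ^ 2 - a ^ 2)) *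
            (Kerr.rPlus M a * Real.log (r - Kerr.rPlus M a) - Kerr.rMinus M a * Real.log (r - Kerr.rMinus M a)) -
          (M / Real.sqrt (M ^ 2 - a ^ 2)) *
            (Kerr.rPlus M a * Real.log (4 * M - Kerr.rPlus M a) -
              Kerr.rMinus M a * Real.log (4 * M - Kerr.rMinus M a)))
    let toKS : ℝ → ℝ → E4 → E4 := fun M a y ↦
      E4.ofTimeSpace (y 0 + blH M a (Kerr.radius a (E4.ofTimeSpace 0 (E4.spatial y)))) (E4.spatial y)
    let gBL : ℝ → ℝ → E4 → E4 →L[ℝ] E4 →L[ℝ] ℝ := fun M a y ↦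
      (Kerr.bilin M a (toKS M a y)).bilinearComp (fderiv ℝ (toKS M a) y) (fderiv ℝ (toKS M a) y)
    ∀ (X : Type) [TopologicalSpace X] [ChartedSpace E3 X] [IsManifold (𝓡 3) ∞ X] [T2Space X]
      [SecondCountableTopology X] [ConnectedSpace X] (D : InitialDataSet (𝓡 3) X)
      (𝒟 : VacuumCauchyDevelopment D) (O : Set 𝒟.carrier) (k : ℕ) (d : FinalStateDecomposition 𝒟.toSpacetime O k)
      (M a r₁ : ℝ) (φ : Kerr.slice a r₁ → X) (Rs : ℝ → ℝ) (Bs : Set X) (κ : ℝ),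
      IsCompact Bs → 0 < κ → 0 ≤ M → |a| ≤ M → Continuous Rs → (∀ t, 16 * M + |a| + 1 ≤ Rs t) →
      (∀ t t' : ℝ, 0 ≤ t → t ≤ t' → Rs t' ≤ Rs t + 2 * (t' - t)) →
      ({y : E4 | -1 < y 0 ∧ Rs (y 0) < E4.spatialNorm y} ⊆ (d.flatDomain : Set E4)) →
      (∀ y : d.flatDomain, -1 < y.1 0 → Rs (y.1 0) < E4.spatialNorm y.1 →
        𝒟.toSpacetime.deviation (Minkowski.backgroundOn d.flatDomain) d.flatChart y =
          gBL M a y.1 - Minkowski.bilin) →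
      (∀ y : d.flatDomain, -1 < y.1 0 → Rs (y.1 0) < E4.spatialNorm y.1 →
        𝒟.timeOrientation.IsFutureDirected (mfderiv 𝓘(ℝ, E4) (𝓡 4) d.flatChart y (E4.basisVector 0))) →
      Set.InjOn d.flatChart {y : d.flatDomain | 0 ≤ y.1 0} →
      IsOpenEmbedding φ → ContMDiff 𝓘(ℝ, E3) (𝓡 3) ∞ φ →
      (∀ ρ : ℝ, IsCompact (φ '' {x : Kerr.slice a r₁ | ρ < ‖(x : E3)‖})ᶜ) →
      (∀ (x : Kerr.slice a r₁) (hx : E4.ofTimeSpace 0 (x : E3) ∈ d.flatDomain), Rs 0 < ‖(x : E3)‖ →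
        d.flatChart ⟨E4.ofTimeSpace 0 (x : E3), hx⟩ = 𝒟.embed (φ x)) →
      (𝒟.metric.causalFuture 𝒟.timeOrientation (range 𝒟.embed) ⊆
        𝒟.metric.causalFuture 𝒟.timeOrientation (𝒟.embed '' Bs) ∪
          d.flatChart '' {y : d.flatDomain | 0 ≤ y.1 0 ∧ Rs (y.1 0) < E4.spatialNorm y.1}) →
      (∀ (i : Fin d.N) (z : E4), d.τ₀ ≤ z 0 →
        Kerr.radius (d.spin i) (poincareInv (d.motion i).1 (d.motion i).2 z) ≤ d.excision i (z 0) →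
          E4.spatialNorm z + κ * z 0 ≤ Rs (z 0)) →
      ∀ [𝒟.metric.HasLeviCivita],
      ∃ L : ℝ, 0 < L ∧ ∀ τ : ℝ, ∃ B₁ : Set X, IsCompact B₁ ∧
        ∀ p ∉ B₁, ∀ (γ : ℝ → 𝒟.carrier) (dom : Set ℝ),
          𝒟.metric.IsNormalisedNullRayFrom 𝒟.timeOrientation 𝒟.embed 𝒟.normal p γ dom →
            ¬ BddAbove dom ∨
              ∃ (s : ℝ) (y : d.flatDomain) (w : E4), τ ≤ y.1 0 ∧
                (s ∈ dom ∧ 0 ≤ s ∧ γ s = d.flatChart y ∧ d.τ₀ < y.1 0 ∧ 0 ≤ y.1 0 ∧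
                  E4.spatialNorm y.1 = Rs (y.1 0) ∧
                  velocity (𝓡 4) γ s = mfderiv 𝓘(ℝ, E4) (𝓡 4) d.flatChart y w ∧
                  𝒟.metric.IsNull (velocity (𝓡 4) γ s) ∧ 0 < w 0 ∧ w 0 ≤ L) := by
  intro blH toKS gBL X _ _ _ _ _ _ D 𝒟 O k d M a r₁ φ Rs Bs κ _hBs hκ hM ha hRs hfloor hslope hZone hExact
    hOrient _hInj _hφemb hφ hφfar hAtt _hCover hSep _inst
  classical
  -- the exact components and the chart components
  have hS : ∀ y, toKS M a y = y + bentHeightFun M a (E4.spatial y) • E4.basisVector 0 :=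
    fun y ↦ toKS_eq_add_smul M a y
  have hG : ∀ y, gBL M a y =
      (Kerr.bilin M a (toKS M a y)).bilinearComp (fderiv ℝ (toKS M a) y) (fderiv ℝ (toKS M a) y) :=
    fun y ↦ rfl
  have hΦ : ContMDiff 𝓘(ℝ, E4) (𝓡 4) ∞ d.flatChart := d.isLateChart_flat.contMDiff
  set Gc : E4 → E4 →L[ℝ] E4 →L[ℝ] ℝ := fun y ↦
    𝒟.toSpacetime.deviationExtend (Minkowski.backgroundOn d.flatDomain) d.flatChart y + Minkowski.bilin
    with hGc
  set Zset : Set E4 := {y : E4 | -1 < y 0 ∧ Rs (y 0) < E4.spatialNorm y} with hZset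
  have hZopen : IsOpen Zset := isOpen_zone hRs
  -- EXACT: on the zone the chart components are the exact components
  have hGZ : ∀ y ∈ Zset, Gc y = gBL M a y := by
    intro y hy
    have hyU : y ∈ d.flatDomain := hZone hy
    have h1 := hExact ⟨y, hyU⟩ hy.1 hy.2
    have e := 𝒟.toSpacetime.deviationExtend_coe (Minkowski.backgroundOn d.flatDomain) d.flatChart ⟨y, hyU⟩
    exact (congrArg (fun B ↦ B + Minkowski.bilin) (e.trans h1)).trans
      (sub_add_cancel (gBL M a y) Minkowski.bilin)
  have hfarZ : ∀ y ∈ closure Zset, 16 * M + |a| + 1 ≤ E4.spatialNorm y :=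
    fun y hy ↦ far_of_mem_closure_zone hRs hfloor hy
  have hG0 : ∀ y, fderiv ℝ (gBL M a) y (E4.basisVector 0) = 0 :=
    fderiv_components_basisVector_zero hS hG
  -- the constants
  refine ⟨10, by norm_num, fun τ ↦ ?_⟩
  set ρ₁ : ℝ := Rs 0 + 4 * (|τ| + |d.τ₀| + 1) with hρ₁
  refine ⟨(φ '' {x : Kerr.slice a r₁ | ρ₁ < ‖(x : E3)‖})ᶜ, hφfar ρ₁, fun p hp γ dom hray ↦ ?_⟩
  simp only [Set.mem_compl_iff, not_not] at hp
  obtain ⟨x, hxρ, rfl⟩ := hp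
  have hxρ' : ρ₁ < ‖(x : E3)‖ := hxρ
  have hxRs : Rs 0 < ‖(x : E3)‖ := by
    have : 0 ≤ |τ| + |d.τ₀| := add_nonneg (abs_nonneg _) (abs_nonneg _)
    linarith
  -- the starting point
  set y₀E : E4 := E4.ofTimeSpace 0 (x : E3) with hy₀E
  have hy₀0 : y₀E 0 = 0 := E4.ofTimeSpace_apply_zero _ _
  have hy₀sp : E4.spatial y₀E = (x : E3) := E4.spatial_ofTimeSpace _ _
  have hy₀N : E4.spatialNorm y₀E = ‖(x : E3)‖ := E4.spatialNorm_ofTimeSpace _ _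
  have hy₀Z : y₀E ∈ Zset := ⟨by rw [hy₀0]; norm_num, by rw [hy₀0, hy₀N]; exact hxRs⟩
  have hy₀U : y₀E ∈ d.flatDomain := hZone hy₀Z
  set y₀ : d.flatDomain := ⟨y₀E, hy₀U⟩ with hy₀
  have hγ0 : γ 0 = d.flatChart y₀ := by rw [hray.apply_zero]; exact (hAtt x hy₀U hxRs).symm
  have hfar₀ : 16 * M + |a| + 1 ≤ E4.spatialNorm y₀E := hfarZ _ (subset_closure hy₀Z)
  have hnd₀ : ∀ u, (∀ v, Gc y₀E u v = 0) → u = 0 := by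
    rw [hGZ _ hy₀Z]; exact components_nondegenerate_far hS hG hM ha hfar₀
  have hy₀range := mem_range_of_nondegenerate _ hnd₀
  have hinj₀ : Function.Injective (mfderiv 𝓘(ℝ, E4) (𝓡 4) d.flatChart y₀) := by
    refine (injective_iff_map_eq_zero _).2 fun v hv ↦ hnd₀ v fun w ↦ ?_
    rw [chartComponents_apply hGc y₀, hv, map_zero]
    rfl
  obtain ⟨w₀, hw₀⟩ := (mfderiv_bijective_of_injective (I := 𝓡 4) (I' := 𝓘(ℝ, E4)) hinj₀ rfl).2
    (velocity (𝓡 4) γ 0)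
  have hT₀ := hOrient y₀ (by rw [show y₀.1 0 = y₀E 0 from rfl, hy₀0]; norm_num)
    (by rw [show y₀.1 = y₀E from rfl, hy₀0, hy₀N]; exact hxRs)
  -- the data normal in the chart, the Killing energy
  have hloc : ∀ᶠ x' : Kerr.slice a r₁ in 𝓝 x, ∃ hx' : E4.ofTimeSpace 0 (x' : E3) ∈ d.flatDomain,
      d.flatChart ⟨_, hx'⟩ = 𝒟.embed (φ x') := by
    have hopen : IsOpen {x' : Kerr.slice a r₁ | Rs 0 < ‖(x' : E3)‖} :=
      isOpen_lt continuous_const continuous_subtype_val.norm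
    filter_upwards [hopen.mem_nhds hxRs] with x' hx'
    have hZ' : E4.ofTimeSpace 0 (x' : E3) ∈ Zset :=
      ⟨by rw [E4.ofTimeSpace_apply_zero]; norm_num,
        by rw [E4.ofTimeSpace_apply_zero, E4.spatialNorm_ofTimeSpace]; exact hx'⟩
    exact ⟨hZone hZ', hAtt x' _ hx'⟩
  obtain ⟨n, hn, hN1, hN2, hN3⟩ := exists_normal_preimage 𝒟 hΦ hGc hφ hy₀U hloc hinj₀
  set E : ℝ := -(Gc y₀E w₀ (E4.basisVector 0)) with hE
  have hTt : Gc y₀E (E4.basisVector 0) (E4.basisVector 0) < 0 := by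
    rw [hGZ _ hy₀Z]; linarith [components_basisVector_zero_far hS hG hM ha hfar₀]
  have hE0 : 0 < E :=
    energy_pos_of_isFutureDirected hGc y₀ hT₀ hTt (by
      rw [hw₀]; exact isFutureDirected_of_eq_point (𝓢 := 𝒟.toSpacetime) hγ0 hray.isFutureDirected_velocity)
  have hnull₀ : Gc y₀E w₀ w₀ = 0 := by
    rw [chartComponents_apply hGc y₀, hw₀, ← metric_val_of_eq_point (𝓢 := 𝒟.toSpacetime) hγ0]
    exact hray.isNull_velocity.1
  have hnorm₀ : Gc y₀E w₀ n = -1 := by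
    rw [chartComponents_apply hGc y₀, hw₀, hn,
      ← metric_val_of_eq_point (𝓢 := 𝒟.toSpacetime) (hγ0.symm.trans hray.apply_zero).symm]
    exact hray.val_velocity_normal
  have hE5 : E ≤ 5 := by
    have h := zone_energy_pinning hS hG hM ha hfar₀ (n := n) (w := w₀)
      (fun q ↦ by rw [← hGZ _ hy₀Z]; exact hN1 q) (by rw [← hGZ _ hy₀Z]; exact hN2)
      (by rw [← hGZ _ hy₀Z]; exact hN3 hT₀) (by rw [← hGZ _ hy₀Z]; exact hnull₀)
      (by rw [← hGZ _ hy₀Z]; exact hnorm₀) (by rw [← hGZ _ hy₀Z]; exact hE0)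
    rwa [← hGZ _ hy₀Z] at h
  -- TRANSPORT
  obtain ⟨z, ż, dom', hdo, hdoc, h0', hsub, hz0, hż0, hW, hγz, hzd, hmom, hcons, hesc⟩ :=
    transport hΦ hGc hray.isMaximalGeodesicOn hray.zero_mem hy₀U hy₀range hγ0 hw₀
  -- conservation of the Killing energy while in the zone, and the rates there
  have hP : ∀ {S : Set ℝ}, Convex ℝ S → (∀ t ∈ S, t ∈ dom' ∧ z t ∈ Zset) → (0 : ℝ) ∈ S →
      ∀ t ∈ S, Gc (z t) (ż t) (E4.basisVector 0) = Gc y₀E w₀ (E4.basisVector 0) := by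
    intro S hS' hSZ h0S t ht
    have := momentum_const hZopen hGZ hG0 hS' (fun r hr ↦ hmom r (hSZ r hr).1 _)
      (fun r hr ↦ (hSZ r hr).2) h0S ht
    rw [this, hz0, hż0]
  have hrate : ∀ t ∈ dom', ∀ hcl : z t ∈ closure Zset, Gc (z t) = gBL M a (z t) →
      Gc (z t) (ż t) (E4.basisVector 0) = Gc y₀E w₀ (E4.basisVector 0) →
      0 < ż t 0 ∧ ż t 0 ≤ 10 ∧ E4.spatialNorm (ż t) ≤ 6 / 5 * ż t 0 ∧ ‖ż t‖ ≤ 22 := by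
    intro t ht hcl hGt hPt
    refine rate_bounds hS hG hM ha (hfarZ _ hcl) (u := ż t) (E := E) ?_ ?_ hE0 hE5
    · rw [← hGt, hcons t ht]; exact hnull₀
    · rw [← hGt, hPt]
  have hGcl : ∀ t ∈ dom', z t ∈ closure Zset → Gc (z t) = gBL M a (z t) := fun t ht hcl ↦
    chartComponents_eq_of_mem_closure hGc hΦ hGZ (hW t ht).1 hcl
      (contDiffAt_components_far hS hG hM ha (hfarZ _ hcl) (n := 0)).continuousAt
  have hz0Z : z 0 ∈ Zset := by rw [hz0]; exact hy₀Z
  -- FIRST EXIT or NO EXIT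
  by_cases hexit : ∃ t ∈ dom', 0 ≤ t ∧ z t ∉ Zset
  · obtain ⟨b, hb, hb0, hbZ⟩ := hexit
    have hIcc : Icc 0 b ⊆ dom' := hdoc.out h0' hb
    have hcont : ContinuousOn z (Icc 0 b) :=
      fun t ht ↦ (hzd t (hIcc ht)).continuousAt.continuousWithinAt
    obtain ⟨T, ⟨hT0, hTb⟩, hTZ, hTcl, hbefore⟩ := exists_firstExit hZopen hb0 hcont hz0Z hbZ
    have hdomT : ∀ t ∈ Icc 0 T, t ∈ dom' := fun t ht ↦ hIcc ⟨ht.1, ht.2.trans hTb⟩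
    have hTdom : T ∈ dom' := hdomT T ⟨hT0.le, le_rfl⟩
    have hPI : ∀ t ∈ Ico 0 T, Gc (z t) (ż t) (E4.basisVector 0) = Gc y₀E w₀ (E4.basisVector 0) :=
      hP (convex_Ico 0 T) (fun r hr ↦ ⟨hdomT r (Ico_subset_Icc_self hr), hbefore r hr⟩) ⟨le_rfl, hT0⟩
    have hPT : Gc (z T) (ż T) (E4.basisVector 0) = Gc y₀E w₀ (E4.basisVector 0) :=
      eq_of_eqOn_Ico (f := fun s ↦ Gc (z s) (ż s) (E4.basisVector 0)) hT0
        (hmom T hTdom _).continuousAt hPI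
    have hTU : z T ∈ d.flatDomain := (hW T hTdom).1
    have hGT := hGcl T hTdom hTcl
    obtain ⟨hwT0, hwT10, -, -⟩ := hrate T hTdom hTcl hGT hPT
    have hball : ∀ t ∈ Icc 0 T, 0 < ż t 0 ∧ E4.spatialNorm (ż t) ≤ 6 / 5 * ż t 0 := by
      intro t ht
      rcases ht.2.eq_or_lt with rfl | htT
      · obtain ⟨h1, -, h3, -⟩ := hrate t hTdom hTcl hGT hPT
        exact ⟨h1, h3⟩
      · have hZt := hbefore t ⟨ht.1, htT⟩
        obtain ⟨h1, -, h3, -⟩ := hrate t (hdomT t ht) (subset_closure hZt) (hGZ _ hZt) (hPI t ⟨ht.1, htT⟩)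
        exact ⟨h1, h3⟩
    have hmono := monotone_time (D := Icc 0 T) ordConnected_Icc (fun t ht ↦ hzd t (hdomT t ht))
      (fun t ht ↦ (hball t ht).1)
    have hzT0 : 0 ≤ z T 0 := by
      have := hmono ⟨le_rfl, hT0.le⟩ ⟨hT0.le, le_rfl⟩ hT0.le
      simp only at this
      rw [hz0, hy₀0] at this
      exact this
    have hdisp := displacement_le (D := Icc 0 T) ordConnected_Icc (fun t ht ↦ hzd t (hdomT t ht))
      (c := 6 / 5) (fun t ht ↦ (hball t ht).2) ⟨le_rfl, hT0.le⟩ ⟨hT0.le, le_rfl⟩ hT0.le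
    rw [hz0, hy₀sp, hy₀0, sub_zero] at hdisp
    have hbdry : E4.spatialNorm (z T) = Rs (z T 0) := spatialNorm_eq_of_frontier hRs hTcl hTZ (by linarith)
    obtain ⟨hτ, hτ₀, hpos⟩ := late_conclusion (late_of_boundary hslope hzT0 hbdry.le hdisp) hxρ'
    -- nullness propagates along the geodesic
    have h2 : ((1 : ℕ∞) : ℕ∞ω) + 1 ≤ ((⊤ : ℕ∞) : ℕ∞ω) := by
      rw [show ((1 : ℕ∞) : ℕ∞ω) + 1 = 2 by norm_num]; exact WithTop.coe_le_coe.2 le_top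
    haveI : CovariantDerivative.ContMDiffCovariantDerivative 𝒟.metric.leviCivita 1 :=
      ⟨𝒟.metric.toPseudoRiemannianMetric.isLocallyContMDiff_leviCivita_holds 1 h2 univ isOpen_univ⟩
    have hnullT : 𝒟.metric.IsNull (velocity (𝓡 4) γ T) :=
      (hray.isMaximalGeodesicOn.isGeodesicOn.isNull_and_isFutureDirected_velocity 𝒟.metric
        𝒟.timeOrientation hray.isMaximalGeodesicOn.isOpen hray.isMaximalGeodesicOn.2.1 hray.zero_mem
        hray.isNull_velocity hray.isFutureDirected_velocity (hsub hTdom)).1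
    exact Or.inr ⟨T, ⟨z T, hTU⟩, ż T, hτ, hsub hTdom, hT0.le, (hγz T hTdom hTU).1, hτ₀, hpos.le,
      hbdry, (hγz T hTdom hTU).2, hnullT, hwT0, hwT10⟩
  · push Not at hexit
    by_cases hbdd : BddAbove dom'
    · exfalso
      set T := sSup dom' with hT
      have hne : dom'.Nonempty := ⟨0, h0'⟩
      have hT0 : 0 < T := by
        obtain ⟨δ, hδ, hball⟩ := Metric.isOpen_iff.1 hdo 0 h0'
        have h1 : δ / 2 ∈ dom' := hball (by
          rw [Metric.mem_ball, Real.dist_eq, sub_zero, abs_of_pos (by linarith)]; linarith)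
        exact lt_of_lt_of_le (by linarith) (le_csSup hbdd h1)
      have hIco : Ico 0 T ⊆ dom' := fun t ht ↦ by
        obtain ⟨t', ht', htt'⟩ := exists_lt_of_lt_csSup hne ht.2
        exact hdoc.out h0' ht' ⟨ht.1, htt'.le⟩
      have hZall : ∀ t ∈ Ico 0 T, z t ∈ Zset := fun t ht ↦ hexit t (hIco ht) ht.1
      have hPI : ∀ t ∈ Ico 0 T, Gc (z t) (ż t) (E4.basisVector 0) = Gc y₀E w₀ (E4.basisVector 0) :=
        hP (convex_Ico 0 T) (fun r hr ↦ ⟨hIco hr, hZall r hr⟩) ⟨le_rfl, hT0⟩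
      have hb : ∀ t ∈ Ico 0 T, 0 < ż t 0 ∧ ż t 0 ≤ 10 ∧ E4.spatialNorm (ż t) ≤ 6 / 5 * ż t 0 ∧
          ‖ż t‖ ≤ 22 := fun t ht ↦
        hrate t (hIco ht) (subset_closure (hZall t ht)) (hGZ _ (hZall t ht)) (hPI t ht)
      obtain ⟨ys, hys, -⟩ := exists_tendsto_of_norm_deriv_le hT0 (fun t ht ↦ hzd t (hIco ht))
        (fun t ht ↦ (hb t ht).2.2.2)
      have hev : ∀ᶠ t in 𝓝[<] T, t ∈ Ico 0 T := by
        filter_upwards [Ioo_mem_nhdsLT hT0] with t ht using ⟨ht.1.le, ht.2⟩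
      have hyscl : ys ∈ closure Zset :=
        mem_closure_of_tendsto hys (hev.mono fun t ht ↦ hZall t ht)
      have hmono := monotone_time (D := Ico 0 T) ordConnected_Ico (fun t ht ↦ hzd t (hIco ht))
        (fun t ht ↦ (hb t ht).1)
      have hys0 : 0 ≤ ys 0 := by
        have hc0 : Continuous fun y : E4 ↦ y 0 := (EuclideanSpace.proj (0 : Fin 4) : E4 →L[ℝ] ℝ).continuous
        refine ge_of_tendsto (hc0.continuousAt.tendsto.comp hys) (hev.mono fun t ht ↦ ?_)
        have := hmono ⟨le_rfl, hT0⟩ ht ht.1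
        simp only at this
        rw [hz0, hy₀0] at this
        exact this
      have hdisp_s : ‖E4.spatial ys - (x : E3)‖ ≤ 6 / 5 * ys 0 := by
        have hcts : Continuous fun y : E4 ↦ 6 / 5 * y 0 - ‖E4.spatial y - (x : E3)‖ :=
          (continuous_const.mul (EuclideanSpace.proj (0 : Fin 4) : E4 →L[ℝ] ℝ).continuous).sub
            ((E4.spatial.continuous.sub continuous_const).norm)
        have hlim := hcts.continuousAt.tendsto.comp hys
        have hnn : (0 : ℝ) ≤ 6 / 5 * ys 0 - ‖E4.spatial ys - (x : E3)‖ := by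
          refine ge_of_tendsto hlim (hev.mono fun t ht ↦ ?_)
          have := displacement_le (D := Ico 0 T) ordConnected_Ico (fun t ht ↦ hzd t (hIco ht))
            (c := 6 / 5) (fun t ht ↦ (hb t ht).2.2.1) ⟨le_rfl, hT0⟩ ht ht.1
          rw [hz0, hy₀sp, hy₀0, sub_zero] at this
          simp only [Function.comp_apply, sub_nonneg]
          exact this
        linarith
      have hysU : ys ∈ d.flatDomain := by
        by_cases hZ : ys ∈ Zset
        · exact hZone hZ
        · have hbd : E4.spatialNorm ys = Rs (ys 0) := spatialNorm_eq_of_frontier hRs hyscl hZ (by linarith)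
          obtain ⟨-, hτ₀, hpos⟩ := late_conclusion (late_of_boundary hslope hys0 hbd.le hdisp_s) hxρ'
          exact mem_flatDomain_of_boundary d hκ hSep hbd hτ₀ hpos
      have hGs : Gc ys = gBL M a ys := chartComponents_eq_of_mem_closure hGc hΦ hGZ hysU hyscl
        (contDiffAt_components_far hS hG hM ha (hfarZ _ hyscl) (n := 0)).continuousAt
      have hysW : ys ∈ (d.flatDomain : Set E4) ∩ Gc ⁻¹' range
          ((↑) : (E4 ≃L[ℝ] (E4 →L[ℝ] ℝ)) → E4 →L[ℝ] (E4 →L[ℝ] ℝ)) := by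
        refine ⟨hysU, ?_⟩
        rw [Set.mem_preimage, hGs]
        exact mem_range_of_nondegenerate _ (components_nondegenerate_far hS hG hM ha (hfarZ _ hyscl))
      obtain ⟨K, hK, hysK, hpathK, hKsub⟩ :=
        isCompact_closedPath hT0 (fun t ht ↦ (hzd t (hIco ht)).continuousAt) hys
      have hKW : K ⊆ (d.flatDomain : Set E4) ∩ Gc ⁻¹' range
          ((↑) : (E4 ≃L[ℝ] (E4 →L[ℝ] ℝ)) → E4 →L[ℝ] (E4 →L[ℝ] ℝ)) := by
        intro q hq
        rcases hKsub q hq with rfl | ⟨t, ht, rfl⟩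
        · exact hysW
        · exact hW t (hIco ht)
      have hTnot : T ∉ dom' := fun hTd ↦ by
        obtain ⟨δ, hδ, hball⟩ := Metric.isOpen_iff.1 hdo T hTd
        have h1 : T + δ / 2 ∈ dom' := hball (by
          rw [Metric.mem_ball, Real.dist_eq, add_sub_cancel_left, abs_of_pos (by linarith)]; linarith)
        have := le_csSup hbdd h1
        linarith
      refine hesc hbdd K hK hKW 22 0 h0' fun t ht hle ↦ ?_
      have htT : t < T := lt_of_le_of_ne (le_csSup hbdd ht) fun h ↦ hTnot (h ▸ ht)
      exact ⟨hpathK t ⟨hle, htT⟩, (hb t ⟨hle, htT⟩).2.2.2⟩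
    · exact Or.inl fun h ↦ hbdd (h.mono hsub)

end Summit.FinalStateConjecture.FinalStateConjecture.Theorems.StarvedNecks.OneOverDelta

end
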